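import Summits.ResolutionOfSingularities.ResolutionOfSingularities.Theorems.WeightedInvariantIota3RowBFaceTails

/-!
# (F-3h) Row B, the BALANCE case — tools  [OURS · L1 W4.3]

Kernel infrastructure for RE-ENTRY OBJECT #1 of chain w43 (door crux `stmt-ResolutionOfSingularities-19897`),
rung (F-3h): the genuine Row-B balance of res-D-brk-1's Frobenius-class argument (O70B-JCAN-PLAN §7, the `x⁵v²`
example): a face term `γ x^c v^{d−1}` (`q c = r₂`) with `p ∤ c`.  In the contradiction branch the sharp engine
leaves exactly `W(v − v_0) = r₂`; the `X₁`-coefficient of `R = v − v_0` is then read off the coefficient of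
`X₀^{(d−1)m₀} X₁` in `h − h_0`, to which the tail does not contribute (`x^c`, `c ≥ 2`, has no linear term).  Tools:

* `r₂_le_weightedOrder_rest_add` — the engine with hypothesis only for `ρ < r₂`, concluding `W(R) ≥ r₂`;
* `initialMonomial_pow` — powers of a series with a single initial monomial have a single initial monomial;
* `coeff_add_mul_of_initialMonomial` — `coeff_{A+B} (F·H) = coeff_A F · coeff_B H` when `W(F) ≥ |A|` and `H`
  has the single initial monomial `X^B`;
* `coeff_rest_balance` — `coeff_{X₁ X₀^{(d−1)m₀}} (v^d − (v^d)_0) = d · coeff_{X₁} R · coeff_{X₀^{(d−1)m₀}} G^{d−1}`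
  when `W(R) = r₂`.

[OURS · L1 W4.3] NOT a statement of the manuscript; AI-produced, gate-checked, weaker than expert review.
-/

set_option linter.dupNamespace false

namespace Summit.ResolutionOfSingularities.ResolutionOfSingularities.Theorems.LocalEngine.Iota3.RowA

open MvPowerSeries IsLocalRing
open Summit.ResolutionOfSingularities.ResolutionOfSingularities.Theorems.LocalEngine.Iota3.PClass
open Summit.ResolutionOfSingularities.ResolutionOfSingularities.Cruxes.HypersurfaceCentreConstruction.LocalEngine.Iota3

variable {K : Type*} [Field K]

/-! ## The engine concluding `W(R) ≥ r₂` -/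

/-- **THE (β) ENGINE, BALANCE FORM**: with the hypothesis on `W(g − g_0)` only for `W(v − v_0) < r₂`, concluding
`W(v − v_0) ≥ r₂` (the balance `W(v − v_0) = r₂` is left to the caller). -/
theorem r₂_le_weightedOrder_rest_add (p : ℕ) [Fact p.Prime] [CharP K p] {d q r₁ r₂ N : ℕ} (hpd : ¬ p ∣ d)
    (hd2 : 2 ≤ d) (hN₂ : d * r₂ = N) (hqr : q < r₂) {Λ : K} (hΛ : Λ ≠ 0) {y v : MvPowerSeries (Fin 3) K}
    {m₀ : ℕ} (hcm : coeff (Finsupp.single 0 m₀) v ≠ 0)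
    (hini : ∀ e, coeff e v ≠ 0 → e ≠ Finsupp.single 0 m₀ →
      Finsupp.weight ![q, r₂, r₁] (Finsupp.single 0 m₀) < Finsupp.weight ![q, r₂, r₁] e)
    (ham : q * m₀ < r₂) (hpm : p ∣ m₀) (g : MvPowerSeries (Fin 3) K)
    (hg : ∀ ρ : ℕ, (v - pClassComponent p 0 v).weightedOrder ![q, r₂, r₁] = ρ → q * m₀ < ρ → ρ < r₂ →
      ((((d - 1) * (q * m₀) + ρ : ℕ)) : ℕ∞) < (g - pClassComponent p 0 g).weightedOrder ![q, r₂, r₁])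
    (hWh : (N : ℕ∞) ≤ (y ^ p + C Λ * v ^ d + g).weightedOrder ![q, r₂, r₁]) :
    (r₂ : ℕ∞) ≤ (v - pClassComponent p 0 v).weightedOrder ![q, r₂, r₁] := by
  classical
  haveI : NeZero p := ⟨(Fact.out : p.Prime).ne_zero⟩
  set G := pClassComponent p 0 v with hGdef
  set R := v - pClassComponent p 0 v with hRdef
  have hclass : exponentClass p (Finsupp.single (0 : Fin 3) m₀) = 0 := by
    rw [exponentClass_eq_zero_iff]
    intro i
    rw [Finsupp.single_apply]
    split_ifs
    · exact hpm
    · exact dvd_zero p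
  have hWG : G.weightedOrder ![q, r₂, r₁] = ((q * m₀ : ℕ) : ℕ∞) := by
    have h := weightedOrder_pClassComponent_of_initialMonomial (![q, r₂, r₁]) p hcm hini
    rw [hclass, weight_single_zero] at h
    exact h
  have hWR : ((q * m₀ : ℕ) : ℕ∞) < R.weightedOrder ![q, r₂, r₁] := by
    have h := weight_lt_weightedOrder_sub_pClassComponent_of_initialMonomial (![q, r₂, r₁]) p hini
    rw [hclass, weight_single_zero] at h
    exact h
  have hG0 : pClassComponent p 0 G = G := by
    rw [hGdef, pClassComponent_pClassComponent, if_pos rfl]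
  have hR0 : pClassComponent p 0 R = 0 := pClassComponent_sub_pClassComponent_self p 0 v
  by_contra hρ
  push Not at hρ
  have hRne : R.weightedOrder ![q, r₂, r₁] ≠ ⊤ := ne_top_of_lt hρ
  obtain ⟨ρ, hρeq⟩ : ∃ ρ : ℕ, R.weightedOrder ![q, r₂, r₁] = ρ := ⟨_, (ENat.coe_toNat hRne).symm⟩
  rw [hρeq, Nat.cast_lt] at hρ
  rw [hρeq, Nat.cast_lt] at hWR
  -- the non-class-0 part `Q` of `v^d` has `W(Q) ≥ N` (coefficientwise)
  set Q := v ^ d - pClassComponent p 0 (v ^ d) with hQdef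
  have hhQ : y ^ p + C Λ * v ^ d + g - pClassComponent p 0 (y ^ p + C Λ * v ^ d + g) =
      C Λ * Q + (g - pClassComponent p 0 g) := by
    rw [pClassComponent_add, pClassComponent_add, pClassComponent_zero_pow_expChar, pClassComponent_C_mul, hQdef]
    ring
  have hQ : ∀ e : Fin 3 →₀ ℕ, Finsupp.weight ![q, r₂, r₁] e < N →
      (Finsupp.weight ![q, r₂, r₁] e : ℕ∞) < (g - pClassComponent p 0 g).weightedOrder ![q, r₂, r₁] →
      coeff e Q = 0 := by
    intro e he heg
    have h1 : coeff e (C Λ * Q + (g - pClassComponent p 0 g)) = 0 := by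
      rw [← hhQ]
      refine coeff_eq_zero_of_lt_weightedOrder _ (lt_of_lt_of_le ?_
        (hWh.trans (le_weightedOrder_sub_pClassComponent _ p 0 _)))
      exact_mod_cast he
    rw [map_add, coeff_C_mul, coeff_eq_zero_of_lt_weightedOrder _ heg, add_zero] at h1
    exact (mul_eq_zero.mp h1).resolve_left hΛ
  -- binomial expansion of `v^d = (R + G)^d` by classes
  have hGpow : ∀ j, pClassComponent p 0 (G ^ j) = G ^ j := pClassComponent_zero_pow_of_pure p hG0
  have hP : ∀ k, pClassComponent p 0 (G ^ (d - k) * (d.choose k : MvPowerSeries (Fin 3) K)) =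
      G ^ (d - k) * (d.choose k : MvPowerSeries (Fin 3) K) := fun k => by
    rw [← map_natCast (C : K →+* MvPowerSeries (Fin 3) K), mul_comm, pClassComponent_C_mul, hGpow]
  have hvRG : v = R + G := by rw [hRdef, hGdef, sub_add_cancel]
  have hQsum : Q = ∑ k ∈ Finset.range (d + 1),
      (R ^ k - pClassComponent p 0 (R ^ k)) * (G ^ (d - k) * (d.choose k : MvPowerSeries (Fin 3) K)) := by
    rw [hQdef, hvRG, add_pow, pClassComponent_sum, ← Finset.sum_sub_distrib]
    refine Finset.sum_congr rfl fun k _ => ?_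
    rw [mul_assoc, pClassComponent_mul_of_right_pure_zero (hP k), sub_mul]
  -- orders of the terms
  have hWd : ((d : ℕ) : MvPowerSeries (Fin 3) K).weightedOrder ![q, r₂, r₁] = 0 := by
    rw [← map_natCast (C : K →+* MvPowerSeries (Fin 3) K)]
    exact weightedOrder_C _ ((CharP.cast_eq_zero_iff K p d).not.mpr hpd)
  have hT1 : ((R ^ 1 - pClassComponent p 0 (R ^ 1)) * (G ^ (d - 1) * (d.choose 1 : MvPowerSeries (Fin 3) K))).weightedOrder
      ![q, r₂, r₁] = ((ρ + (d - 1) * (q * m₀) : ℕ) : ℕ∞) := by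
    rw [pow_one, hR0, sub_zero, Nat.choose_one_right, weightedOrder_mul, weightedOrder_mul, weightedOrder_pow,
      hWG, hWd, hρeq, add_zero, nsmul_eq_mul]
    push_cast
    ring
  have hTk : ∀ k ∈ Finset.range (d + 1), 2 ≤ k →
      (((ρ + (d - 1) * (q * m₀) : ℕ) : ℕ∞)) <
        ((R ^ k - pClassComponent p 0 (R ^ k)) * (G ^ (d - k) * (d.choose k : MvPowerSeries (Fin 3) K))).weightedOrder
          ![q, r₂, r₁] := by
    intro k hk hk2
    rw [Finset.mem_range] at hk
    have hnum := lt_binomial_weight hk2 (Nat.lt_succ_iff.mp hk) hWR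
    refine lt_of_lt_of_le (b := (((k * ρ + (d - k) * (q * m₀) : ℕ) : ℕ∞))) (by exact_mod_cast hnum) ?_
    refine le_trans ?_ (le_weightedOrder_mul _)
    have h1 : (((k * ρ : ℕ)) : ℕ∞) ≤ (R ^ k - pClassComponent p 0 (R ^ k)).weightedOrder ![q, r₂, r₁] := by
      refine le_trans ?_ (le_weightedOrder_sub_pClassComponent _ p 0 _)
      rw [weightedOrder_pow, hρeq, nsmul_eq_mul, Nat.cast_mul]
    have h2 : ((((d - k) * (q * m₀) : ℕ)) : ℕ∞) ≤
        (G ^ (d - k) * (d.choose k : MvPowerSeries (Fin 3) K)).weightedOrder ![q, r₂, r₁] := by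
      refine le_trans ?_ (le_weightedOrder_mul _)
      rw [weightedOrder_pow, hWG, nsmul_eq_mul, Nat.cast_mul]
      exact le_self_add
    push_cast at h1 h2 ⊢
    exact add_le_add h1 h2
  -- the `k = 1` term has a nonzero coefficient of weight `ρ + (d-1)a`, invisible to the other terms
  have hfin : ((((R ^ 1 - pClassComponent p 0 (R ^ 1)) * (G ^ (d - 1) * (d.choose 1 : MvPowerSeries (Fin 3) K))).weightedOrder
      ![q, r₂, r₁]).toNat : ℕ∞) =
      ((R ^ 1 - pClassComponent p 0 (R ^ 1)) * (G ^ (d - 1) * (d.choose 1 : MvPowerSeries (Fin 3) K))).weightedOrder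
        ![q, r₂, r₁] := by
    rw [hT1]; rfl
  obtain ⟨e, hce, hwe⟩ := exists_coeff_ne_zero_and_weightedOrder _ hfin
  rw [hT1, Nat.cast_inj] at hwe
  have hcoeffQ : coeff e Q = coeff e ((R ^ 1 - pClassComponent p 0 (R ^ 1)) *
      (G ^ (d - 1) * (d.choose 1 : MvPowerSeries (Fin 3) K))) := by
    rw [hQsum, map_sum]
    refine Finset.sum_eq_single 1 (fun k hk hk1 => ?_) (fun h => absurd (Finset.mem_range.mpr (by omega)) h)
    rcases Nat.lt_or_ge k 2 with hk2 | hk2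
    · -- k = 0
      have hk0 : k = 0 := by omega
      have h1 : pClassComponent p 0 (1 : MvPowerSeries (Fin 3) K) = 1 := by
        have h := hGpow 0
        rwa [pow_zero] at h
      rw [hk0, pow_zero, h1, sub_self, zero_mul, map_zero]
    · refine coeff_eq_zero_of_lt_weightedOrder (![q, r₂, r₁]) ?_
      rw [hwe]
      exact hTk k hk hk2
  have hlight : Finsupp.weight ![q, r₂, r₁] e < N := by
    rw [hwe, ← hN₂]
    have h1 : (d - 1) * (q * m₀) ≤ (d - 1) * (r₂ - 1) := Nat.mul_le_mul_left _ (by omega)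
    have h2 : ρ + (d - 1) * (r₂ - 1) < d * r₂ := by
      obtain ⟨j, rfl⟩ := Nat.exists_eq_add_of_le hd2
      obtain ⟨i, rfl⟩ := Nat.exists_eq_add_of_le (Nat.one_le_of_lt hqr)
      rw [show 2 + j - 1 = j + 1 by omega, show 1 + i - 1 = i by omega]
      nlinarith
    omega
  have hlight' : (Finsupp.weight ![q, r₂, r₁] e : ℕ∞) < (g - pClassComponent p 0 g).weightedOrder ![q, r₂, r₁] := by
    rw [hwe, show ρ + (d - 1) * (q * m₀) = (d - 1) * (q * m₀) + ρ from by ring]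
    exact hg ρ hρeq hWR hρ
  exact absurd (hcoeffQ ▸ hQ e hlight hlight') hce




/-! ## Initial monomials of powers and coefficient extraction -/

/-- Powers of a series with single initial monomial `X^m` (for the weights `w`) have the single initial monomial
`X^{k m}`. -/
theorem initialMonomial_pow {σ : Type*} (w : σ → ℕ) {F : MvPowerSeries σ K} {m : σ →₀ ℕ}
    (hini : ∀ B, coeff B F ≠ 0 → B ≠ m → Finsupp.weight w m < Finsupp.weight w B) (k : ℕ) :
    ∀ B, coeff B (F ^ k) ≠ 0 → B ≠ k • m → Finsupp.weight w (k • m) < Finsupp.weight w B := by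
  classical
  have hge : ∀ B, coeff B F ≠ 0 → Finsupp.weight w m ≤ Finsupp.weight w B := fun B hB => by
    by_cases h : B = m
    · rw [h]
    · exact (hini B hB h).le
  induction k with
  | zero =>
    intro B hB hne
    rw [pow_zero, coeff_one] at hB
    split_ifs at hB with h0
    · exact absurd (by rw [h0, zero_smul]) hne
    · exact absurd rfl hB
  | succ k ih =>
    intro B hB hne
    rw [pow_succ, coeff_mul] at hB
    obtain ⟨⟨A, A'⟩, hAA', hprod⟩ := Finset.exists_ne_zero_of_sum_ne_zero hB
    rw [Finset.HasAntidiagonal.mem_antidiagonal] at hAA'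
    dsimp only at hAA' hprod
    have hA : coeff A (F ^ k) ≠ 0 := left_ne_zero_of_mul hprod
    have hA' : coeff A' F ≠ 0 := right_ne_zero_of_mul hprod
    have hgeA : Finsupp.weight w (k • m) ≤ Finsupp.weight w A := by
      by_cases h : A = k • m
      · rw [h]
      · exact (ih A hA h).le
    have hgeA' := hge A' hA'
    rw [← hAA', map_add, succ_nsmul, map_add]
    by_cases h : A = k • m
    · have h' : A' ≠ m := fun h' => hne (by rw [← hAA', h, h', succ_nsmul])
      have := hini A' hA' h'
      omega
    · have := ih A hA h
      omega

/-- COEFFICIENT EXTRACTION: if `W(F) ≥ |A|` and `H` has the single initial monomial `X^B`, then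
`coeff_{A+B}(F · H) = coeff_A F · coeff_B H`. -/
theorem coeff_add_mul_of_initialMonomial {σ : Type*} (w : σ → ℕ) {F H : MvPowerSeries σ K} {A B : σ →₀ ℕ}
    (hF : (Finsupp.weight w A : ℕ∞) ≤ F.weightedOrder w)
    (hH : ∀ B', coeff B' H ≠ 0 → B' ≠ B → Finsupp.weight w B < Finsupp.weight w B') :
    coeff (A + B) (F * H) = coeff A F * coeff B H := by
  classical
  rw [coeff_mul, Finset.sum_eq_single (A, B)]
  · rintro ⟨A₁, B₁⟩ hmem hne
    rw [Finset.HasAntidiagonal.mem_antidiagonal] at hmem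
    dsimp only at hmem ⊢
    by_cases hA₁ : coeff A₁ F = 0
    · rw [hA₁, zero_mul]
    · have hwA : Finsupp.weight w A ≤ Finsupp.weight w A₁ := by
        have h := hF.trans (weightedOrder_le w hA₁)
        exact_mod_cast h
      by_cases hB₁ : B₁ = B
      · rw [hB₁] at hmem
        exact (hne (Prod.ext (add_right_cancel hmem) hB₁)).elim
      · by_cases hcB : coeff B₁ H = 0
        · rw [hcB, mul_zero]
        · have h1 := hH B₁ hcB hB₁
          have h2 := congrArg (Finsupp.weight w) hmem
          rw [map_add, map_add] at h2
          omega
  · intro h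
    exact (h (Finset.HasAntidiagonal.mem_antidiagonal.mpr rfl)).elim

/-- The weight of a multiple of `e₀` plus `e₁`: `|e₁ + k·e₀| = r₂ + q k`. -/
theorem weight_single_one_add (q r₁ r₂ k : ℕ) :
    Finsupp.weight ![q, r₂, r₁] (Finsupp.single 1 1 + Finsupp.single 0 k) = r₂ + q * k := by
  rw [map_add, weight_single_one, weight_single_zero]

/-! ## The `X₀^{(d−1)m₀} X₁`-coefficient of `v^d − (v^d)_0` at the balance -/

/-- **BALANCE COEFFICIENT.**  For `v` with single initial monomial `X₀^{m₀}`, `p ∣ m₀`, `q m₀ < r₂`, `G = v_0`,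
`R = v − v_0` with `W(R) = r₂`: the coefficient of `X₁·X₀^{(d−1)m₀}` in `v^d − (v^d)_0` is
`d · coeff_{X₁} R · coeff_{X₀^{(d−1)m₀}} G^{d−1}`, and the last factor is nonzero. -/
theorem coeff_rest_balance (p : ℕ) [Fact p.Prime] [CharP K p] {d q r₁ r₂ : ℕ} (hd2 : 2 ≤ d)
    {v : MvPowerSeries (Fin 3) K} {m₀ : ℕ} (hcm : coeff (Finsupp.single 0 m₀) v ≠ 0)
    (hini : ∀ e, coeff e v ≠ 0 → e ≠ Finsupp.single 0 m₀ →
      Finsupp.weight ![q, r₂, r₁] (Finsupp.single 0 m₀) < Finsupp.weight ![q, r₂, r₁] e)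
    (ham : q * m₀ < r₂) (hpm : p ∣ m₀)
    (hWR : (v - pClassComponent p 0 v).weightedOrder ![q, r₂, r₁] = (r₂ : ℕ∞)) :
    coeff (Finsupp.single 1 1 + Finsupp.single 0 ((d - 1) * m₀)) (v ^ d - pClassComponent p 0 (v ^ d)) =
      (d : K) * (coeff (Finsupp.single 1 1) (v - pClassComponent p 0 v) *
        coeff (Finsupp.single 0 ((d - 1) * m₀)) (pClassComponent p 0 v ^ (d - 1))) ∧
    coeff (Finsupp.single 0 ((d - 1) * m₀)) (pClassComponent p 0 v ^ (d - 1)) ≠ 0 := by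
  classical
  haveI : NeZero p := ⟨(Fact.out : p.Prime).ne_zero⟩
  set G := pClassComponent p 0 v with hGdef
  set R := v - pClassComponent p 0 v with hRdef
  have hclass : exponentClass p (Finsupp.single (0 : Fin 3) m₀) = 0 := by
    rw [exponentClass_eq_zero_iff]
    intro i
    rw [Finsupp.single_apply]
    split_ifs
    · exact hpm
    · exact dvd_zero p
  -- `G` has the single initial monomial `X₀^{m₀}` as well
  have hcmG : coeff (Finsupp.single 0 m₀) G ≠ 0 := by
    rw [hGdef, ← hclass, coeff_pClassComponent_initialMonomial]; exact hcm
  have hiniG : ∀ e, coeff e G ≠ 0 → e ≠ Finsupp.single 0 m₀ →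
      Finsupp.weight ![q, r₂, r₁] (Finsupp.single 0 m₀) < Finsupp.weight ![q, r₂, r₁] e := by
    intro e he hne
    rw [hGdef, ← hclass] at he
    exact initialMonomial_pClassComponent _ p hini e he hne
  have hWG : G.weightedOrder ![q, r₂, r₁] = ((q * m₀ : ℕ) : ℕ∞) := by
    have h := weightedOrder_pClassComponent_of_initialMonomial (![q, r₂, r₁]) p hcm hini
    rw [hclass, weight_single_zero] at h
    exact h
  have hWR' : ((q * m₀ : ℕ) : ℕ∞) < R.weightedOrder ![q, r₂, r₁] := by
    rw [hRdef, hWR, Nat.cast_lt]; exact ham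
  have hG0 : pClassComponent p 0 G = G := by
    rw [hGdef, pClassComponent_pClassComponent, if_pos rfl]
  have hR0 : pClassComponent p 0 R = 0 := pClassComponent_sub_pClassComponent_self p 0 v
  have hνne : coeff (Finsupp.single 0 ((d - 1) * m₀)) (G ^ (d - 1)) ≠ 0 :=
    coeff_single_pow_ne_zero hcmG hiniG (by omega)
  refine ⟨?_, hνne⟩
  -- expansion by classes
  have hGpow : ∀ j, pClassComponent p 0 (G ^ j) = G ^ j := pClassComponent_zero_pow_of_pure p hG0
  have hP : ∀ k, pClassComponent p 0 (G ^ (d - k) * (d.choose k : MvPowerSeries (Fin 3) K)) =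
      G ^ (d - k) * (d.choose k : MvPowerSeries (Fin 3) K) := fun k => by
    rw [← map_natCast (C : K →+* MvPowerSeries (Fin 3) K), mul_comm, pClassComponent_C_mul, hGpow]
  have hvRG : v = R + G := by rw [hRdef, hGdef, sub_add_cancel]
  have hQsum : v ^ d - pClassComponent p 0 (v ^ d) = ∑ k ∈ Finset.range (d + 1),
      (R ^ k - pClassComponent p 0 (R ^ k)) * (G ^ (d - k) * (d.choose k : MvPowerSeries (Fin 3) K)) := by
    rw [hvRG, add_pow, pClassComponent_sum, ← Finset.sum_sub_distrib]
    refine Finset.sum_congr rfl fun k _ => ?_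
    rw [mul_assoc, pClassComponent_mul_of_right_pure_zero (hP k), sub_mul]
  have hwE : Finsupp.weight ![q, r₂, r₁] (Finsupp.single 1 1 + Finsupp.single 0 ((d - 1) * m₀)) =
      r₂ + (d - 1) * (q * m₀) := by
    rw [weight_single_one_add]; ring
  -- the terms `k ≥ 2` weigh more than `|E|`, the term `k = 0` vanishes
  have hTk : ∀ k ∈ Finset.range (d + 1), 2 ≤ k →
      (((r₂ + (d - 1) * (q * m₀) : ℕ) : ℕ∞)) <
        ((R ^ k - pClassComponent p 0 (R ^ k)) * (G ^ (d - k) * (d.choose k : MvPowerSeries (Fin 3) K))).weightedOrder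
          ![q, r₂, r₁] := by
    intro k hk hk2
    rw [Finset.mem_range] at hk
    have hnum := lt_binomial_weight hk2 (Nat.lt_succ_iff.mp hk) ham
    refine lt_of_lt_of_le (b := (((k * r₂ + (d - k) * (q * m₀) : ℕ) : ℕ∞))) (by exact_mod_cast hnum) ?_
    refine le_trans ?_ (le_weightedOrder_mul _)
    have h1 : (((k * r₂ : ℕ)) : ℕ∞) ≤ (R ^ k - pClassComponent p 0 (R ^ k)).weightedOrder ![q, r₂, r₁] := by
      refine le_trans ?_ (le_weightedOrder_sub_pClassComponent _ p 0 _)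
      rw [weightedOrder_pow, hRdef, hWR, nsmul_eq_mul, Nat.cast_mul]
    have h2 : ((((d - k) * (q * m₀) : ℕ)) : ℕ∞) ≤
        (G ^ (d - k) * (d.choose k : MvPowerSeries (Fin 3) K)).weightedOrder ![q, r₂, r₁] := by
      refine le_trans ?_ (le_weightedOrder_mul _)
      rw [weightedOrder_pow, hWG, nsmul_eq_mul, Nat.cast_mul]
      exact le_self_add
    push_cast at h1 h2 ⊢
    exact add_le_add h1 h2
  rw [hQsum, map_sum, Finset.sum_eq_single 1 (fun k hk hk1 => ?_) (fun h => absurd (Finset.mem_range.mpr (by omega)) h)]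
  · -- the `k = 1` term: `R · (G^{d-1} · d)`
    rw [pow_one, hR0, sub_zero, Nat.choose_one_right, ← mul_assoc, ← map_natCast (C : K →+* MvPowerSeries (Fin 3) K),
      coeff_mul_C, coeff_add_mul_of_initialMonomial (![q, r₂, r₁]) (by rw [weight_single_one, hRdef, hWR]) ?_]
    · ring
    · intro B hB hne
      have h := initialMonomial_pow (![q, r₂, r₁]) hiniG (d - 1) B hB
        (by rwa [Finsupp.smul_single, smul_eq_mul])
      rwa [Finsupp.smul_single, smul_eq_mul] at h
  · rcases Nat.lt_or_ge k 2 with hk2 | hk2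
    · have hk0 : k = 0 := by omega
      have h1 : pClassComponent p 0 (1 : MvPowerSeries (Fin 3) K) = 1 := by
        have h := hGpow 0
        rwa [pow_zero] at h
      rw [hk0, pow_zero, h1, sub_self, zero_mul, map_zero]
    · refine coeff_eq_zero_of_lt_weightedOrder (![q, r₂, r₁]) ?_
      rw [hwE]
      exact hTk k hk hk2

end Summit.ResolutionOfSingularities.ResolutionOfSingularities.Theorems.LocalEngine.Iota3.RowA
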